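import Mathlib
import Literature.NumberTheory.DiophantineGeometry.TernaryConicPointBound
import Literature.NumberTheory.DiophantineGeometry.TernaryConicPointBoundBinary
import Literature.NumberTheory.DiophantineGeometry.TernaryConicPointBoundPlane

/-!
# Local classes of zeros of a ternary quadratic form at a prime

Auxiliary file (theorems only, no definitions) for the proof of **Heath-Brown's bound for primitive
zeros of a ternary quadratic form in a box** (`Literature.NumberTheory.DiophantineGeometry.
TernaryConicPointBound`, [Heathbrown2002, Cor. 2], discharged in `TernaryConicPointBoundProofs`).

* `TernaryConic.local_labels` (**local classes**, replacing the lattices of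
  [Heathbrown1997, §2, proof of Thm 2]): for a prime `ℓ` and a symmetric integral `3 × 3` matrix `M`
  with `det M ≠ 0`, `e = v_ℓ(det M)`, `f = v_ℓ(Δ₀(M))` (`Δ₀` = `minorGcd`, the gcd of the `2 × 2`
  minors), the zeros of `xᵀ M x` carry `≤ 3e + 3` labels such that two zeros `x, y` with equal
  labels satisfy `ℓ^m ∣ xᵀ M y`, for an exponent `m` with `3e ≤ 3m + 4f` (`+ 3` when `ℓ = 2`).

Construction: let `adj M = ℓ^f N₀` with `N₀` having a unit entry `(i, j)` modulo `ℓ`; then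
`ℓ^f ∣ det M`, `det M = ℓ^f d`, `γ = v_ℓ(d) = e - f`, and the `j`-th column of `N₀` is a kernel vector
of `M` modulo `ℓ^γ`; normalising its `i`-th coordinate to `1` (`w`), the bilinear form `xᵀ M y` is,
modulo `ℓ^γ`, the binary form of the block complementary to `i` at the reduced vectors
`x - xᵢ w` (`dot_mulVec_decomp`), and the binary lemma `bin_labels` at level `γ` applies; the factor
`2` of the polar form costs one power only at `ℓ = 2`.  The printed proof obtains
`∏ ℓ^m ≥ Δ/(2^8 Δ₀²)`; here `3m + 4f ≥ 3e` gives `(∏ ℓ^m)³ Δ₀⁴ ≥ Δ³/8`, which is what the Gram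
determinant argument consumes.

## References

* D. R. Heath-Brown, *The density of rational points on cubic surfaces*, Acta Arith. 79 (1997)
  17–30, §2 [Heathbrown1997].
* D. R. Heath-Brown, *The density of rational points on curves and surfaces*, Ann. of Math. 155
  (2002) 553–595, Corollary 2 [Heathbrown2002].
-/

namespace Literature.NumberTheory.DiophantineGeometry

namespace TernaryConic

open Finset Matrix

/-- `Δ₀(M)` divides every entry of the adjugate. [folklore] -/
theorem minorGcd_dvd_adjugate (M : Matrix (Fin 3) (Fin 3) ℤ) (i j : Fin 3) :
    minorGcd M ∣ M.adjugate i j := by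
  have h := Finset.gcd_dvd (f := fun ij : Fin 3 × Fin 3 => M.adjugate ij.1 ij.2)
    (Finset.mem_univ (i, j))
  exact h

/-- A common divisor of the entries of the adjugate divides `Δ₀(M)`. [folklore] -/
theorem dvd_minorGcd (M : Matrix (Fin 3) (Fin 3) ℤ) (c : ℤ) (h : ∀ i j, c ∣ M.adjugate i j) :
    c ∣ minorGcd M := by
  unfold minorGcd
  exact Finset.dvd_gcd fun ij _ => h ij.1 ij.2

/-- `Δ₀(M) = 0` forces the adjugate to vanish. [folklore] -/
theorem adjugate_eq_zero_of_minorGcd_eq_zero (M : Matrix (Fin 3) (Fin 3) ℤ) (h0 : minorGcd M = 0) :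
    M.adjugate = 0 := by
  unfold minorGcd at h0
  rw [Finset.gcd_eq_zero_iff] at h0
  ext i j
  exact h0 (i, j) (Finset.mem_univ _)

/-- **Local classes** (replacing the lattices of [Heathbrown1997, §2, proof of Thm 2]). For a
prime `ℓ` and a symmetric integral `3 × 3` matrix `M` with `det M ≠ 0`, write
`e = v_ℓ(det M)`, `f = v_ℓ(Δ₀)` (`Δ₀` = gcd of the `2 × 2` minors). The zeros of `xᵀ M x` carry
`≤ 3e + 3` labels such that two zeros `x, y` with equal labels have `ℓ^m ∣ xᵀ M y`, where
`3e ≤ 3m + 4f` (`+ 3` if `ℓ = 2`). Construction: a column `w` of `adj M / ℓ^f` with a unit entry is a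
kernel vector of `M` modulo `ℓ^{e-f}`; along `w` the form reduces to a binary form modulo `ℓ^{e-f}`,
to which the binary lemma applies. [folklore] -/
theorem local_labels {ℓ : ℕ} (hℓ : ℓ.Prime) (M : Matrix (Fin 3) (Fin 3) ℤ) (hM : M.IsSymm)
    (hdet : M.det ≠ 0) :
    ∃ (m : ℕ) (lab : (Fin 3 → ℤ) → ℕ) (L : Finset ℕ),
      #L ≤ 3 * padicValNat ℓ M.det.natAbs + 3 ∧
      3 * padicValNat ℓ M.det.natAbs ≤
        3 * m + 4 * padicValNat ℓ (minorGcd M).natAbs + (if ℓ = 2 then 3 else 0) ∧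
      (∀ x : Fin 3 → ℤ, x ⬝ᵥ M *ᵥ x = 0 → lab x ∈ L) ∧
      (∀ x y : Fin 3 → ℤ, x ⬝ᵥ M *ᵥ x = 0 → y ⬝ᵥ M *ᵥ y = 0 → lab x = lab y →
        (ℓ : ℤ) ^ m ∣ x ⬝ᵥ M *ᵥ y) := by
  classical
  haveI : Fact ℓ.Prime := ⟨hℓ⟩
  have hℓ' : Prime (ℓ : ℤ) := Nat.prime_iff_prime_int.mp hℓ
  have hP0 : (ℓ : ℤ) ≠ 0 := by exact_mod_cast hℓ.ne_zero
  -- powers of `ℓ` dividing an integer, via `padicValNat` of the absolute value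
  have hpow_dvd : ∀ z : ℤ, (ℓ : ℤ) ^ padicValNat ℓ z.natAbs ∣ z := by
    intro z
    have h1 : ℓ ^ padicValNat ℓ z.natAbs ∣ z.natAbs := pow_padicValNat_dvd
    rw [← Int.natCast_dvd] at h1
    push_cast at h1
    exact h1
  have hle_of_dvd : ∀ (z : ℤ) (k : ℕ), z ≠ 0 → (ℓ : ℤ) ^ k ∣ z → k ≤ padicValNat ℓ z.natAbs := by
    intro z k hz hk
    have h1 : ℓ ^ k ∣ z.natAbs := by
      rw [← Int.natCast_dvd]; push_cast; exact hk
    exact (padicValNat_dvd_iff_le (Int.natAbs_ne_zero.mpr hz)).mp h1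
  -- `f` and the reduced adjugate `N0`
  have hadjM : M * M.adjugate = M.det • (1 : Matrix (Fin 3) (Fin 3) ℤ) := Matrix.mul_adjugate M
  have hg0 : minorGcd M ≠ 0 := by
    intro h0
    have hA : M.adjugate = 0 := adjugate_eq_zero_of_minorGcd_eq_zero M h0
    have h1 := congrFun (congrFun hadjM 0) 0
    rw [hA, Matrix.mul_zero] at h1
    simp at h1
    exact hdet h1.symm
  obtain ⟨f, hf⟩ : ∃ f : ℕ, padicValNat ℓ (minorGcd M).natAbs = f := ⟨_, rfl⟩
  have hfadj : ∀ i j, (ℓ : ℤ) ^ f ∣ M.adjugate i j := fun i j => by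
    rw [← hf]
    exact (hpow_dvd (minorGcd M)).trans (minorGcd_dvd_adjugate M i j)
  obtain ⟨N0, hN0⟩ : ∃ N0 : Matrix (Fin 3) (Fin 3) ℤ, ∀ i j, M.adjugate i j = (ℓ : ℤ) ^ f * N0 i j :=
    ⟨fun i j => M.adjugate i j / (ℓ : ℤ) ^ f, fun i j => (Int.mul_ediv_cancel' (hfadj i j)).symm⟩
  have hunit : ∃ i j, ¬ (ℓ : ℤ) ∣ N0 i j := by
    by_contra hall
    push Not at hall
    have h1 : (ℓ : ℤ) ^ (f + 1) ∣ minorGcd M := by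
      refine dvd_minorGcd M _ fun i' j' => ?_
      rw [hN0 i' j', pow_succ]
      exact mul_dvd_mul_left _ (hall i' j')
    have := hle_of_dvd _ _ hg0 h1
    rw [hf] at this
    omega
  obtain ⟨i, j, hij⟩ := hunit
  -- `d = det M / ℓ^f` and `γ = v_ℓ(d)`
  have hdetf : (ℓ : ℤ) ^ f ∣ M.det := by
    have h1 := congrFun (congrFun hadjM j) j
    simp only [Matrix.mul_apply, Matrix.smul_apply, Matrix.one_apply_eq, smul_eq_mul, mul_one] at h1
    rw [← h1]
    exact Finset.dvd_sum fun k _ => (hfadj k j).mul_left _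
  obtain ⟨d, hd⟩ := hdetf
  have hd0 : d ≠ 0 := by rintro rfl; rw [mul_zero] at hd; exact hdet hd
  obtain ⟨γ, hγ⟩ : ∃ γ : ℕ, padicValNat ℓ d.natAbs = γ := ⟨_, rfl⟩
  have hγd : (ℓ : ℤ) ^ γ ∣ d := by rw [← hγ]; exact hpow_dvd d
  have he : padicValNat ℓ M.det.natAbs = f + γ := by
    rw [hd, Int.natAbs_mul, Int.natAbs_pow, Int.natAbs_natCast,
      padicValNat.mul (pow_ne_zero _ hℓ.ne_zero) (Int.natAbs_ne_zero.mpr hd0), padicValNat.prime_pow,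
      hγ]
  -- the kernel vector: column `j` of `N0`, normalised at `i`
  have hcol : ∀ k, (ℓ : ℤ) ^ γ ∣ (M *ᵥ fun r => N0 r j) k := by
    intro k
    have h1 := congrFun (congrFun hadjM k) j
    simp only [Matrix.mul_apply, Matrix.smul_apply, smul_eq_mul] at h1
    have h2 : (ℓ : ℤ) ^ f * (M *ᵥ fun r => N0 r j) k =
        (ℓ : ℤ) ^ f * (d * (1 : Matrix (Fin 3) (Fin 3) ℤ) k j) := by
      rw [← mul_assoc, ← hd, ← h1]
      simp only [Matrix.mulVec, dotProduct, Finset.mul_sum]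
      refine Finset.sum_congr rfl fun r _ => ?_
      rw [hN0 r j]; ring
    have h3 := mul_left_cancel₀ (pow_ne_zero _ hP0) h2
    rw [h3]
    exact hγd.mul_right _
  obtain ⟨w, hwi, hw⟩ : ∃ w : Fin 3 → ℤ, w i = 1 ∧ ∀ k, (ℓ : ℤ) ^ γ ∣ (M *ᵥ w) k := by
    obtain ⟨c, c', hcc⟩ : IsCoprime (N0 i j) ((ℓ : ℤ) ^ γ) :=
      ((Prime.coprime_iff_not_dvd hℓ').2 hij).symm.pow_right
    refine ⟨c • (fun r => N0 r j) + (c' * (ℓ : ℤ) ^ γ) • (Pi.single i 1 : Fin 3 → ℤ), ?_, ?_⟩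
    · simp only [Pi.add_apply, Pi.smul_apply, smul_eq_mul, Pi.single_eq_same, mul_one]
      linarith
    · intro k
      rw [Matrix.mulVec_add, Matrix.mulVec_smul, Matrix.mulVec_smul]
      simp only [Pi.add_apply, Pi.smul_apply, smul_eq_mul]
      exact dvd_add ((hcol k).mul_left _) ((dvd_mul_left _ _).mul_right _)
  -- the binary form along `w`
  obtain ⟨j₁, hj₁⟩ : ∃ j₁ : Fin 3, j₁ = ![1, 0, 0] i := ⟨_, rfl⟩
  obtain ⟨j₂, hj₂⟩ : ∃ j₂ : Fin 3, j₂ = ![2, 2, 1] i := ⟨_, rfl⟩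
  obtain ⟨U, hU⟩ : ∃ U : (Fin 3 → ℤ) → ℤ, ∀ x, x j₁ - w j₁ * x i = U x := ⟨_, fun _ => rfl⟩
  obtain ⟨V, hV⟩ : ∃ V : (Fin 3 → ℤ) → ℤ, ∀ x, x j₂ - w j₂ * x i = V x := ⟨_, fun _ => rfl⟩
  have hrem : ∀ x y : Fin 3 → ℤ, (ℓ : ℤ) ^ γ ∣ x ⬝ᵥ M *ᵥ y -
      (M j₁ j₁ * U x * U y + M j₁ j₂ * (U x * V y + U y * V x) + M j₂ j₂ * V x * V y) := by
    intro x y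
    rw [dot_mulVec_decomp M hM w x y i j₁ j₂ hj₁ hj₂ hwi, hU x, hU y, hV x, hV y, add_sub_cancel_left]
    refine dvd_add (dvd_add ?_ ?_) ?_
    · exact (dvd_add ((hw _).mul_left _) ((hw _).mul_left _)).mul_left _
    · exact (dvd_add ((hw _).mul_left _) ((hw _).mul_left _)).mul_left _
    · exact (dvd_add (dvd_add ((hw _).mul_left _) ((hw _).mul_left _)) ((hw _).mul_left _)).mul_left _
  -- labels from the binary lemma
  obtain ⟨lab2, L, hL, hmem, hpol⟩ := bin_labels hℓ γ (M j₁ j₁) (2 * M j₁ j₂) (M j₂ j₂)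
  have hzero : ∀ x : Fin 3 → ℤ, x ⬝ᵥ M *ᵥ x = 0 →
      (ℓ : ℤ) ^ γ ∣ M j₁ j₁ * (U x, V x).1 ^ 2 + 2 * M j₁ j₂ * (U x, V x).1 * (U x, V x).2
        + M j₂ j₂ * (U x, V x).2 ^ 2 := by
    intro x hx
    have h1 := hrem x x
    rw [hx, zero_sub, dvd_neg] at h1
    rw [show M j₁ j₁ * (U x, V x).1 ^ 2 + 2 * M j₁ j₂ * (U x, V x).1 * (U x, V x).2
        + M j₂ j₂ * (U x, V x).2 ^ 2 =
      M j₁ j₁ * U x * U x + M j₁ j₂ * (U x * V x + U x * V x) + M j₂ j₂ * V x * V x by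
        simp only; ring]
    exact h1
  obtain ⟨t, ht⟩ : ∃ t : ℕ, t = if ℓ = 2 then 1 else 0 := ⟨_, rfl⟩
  refine ⟨γ - t, fun x => lab2 (U x, V x), L, ?_, ?_, fun x hx => hmem _ (hzero x hx), ?_⟩
  · rw [he]; omega
  · rw [he, hf]
    by_cases h2 : ℓ = 2
    · rw [if_pos h2] at ht ⊢; omega
    · rw [if_neg h2] at ht ⊢; omega
  · intro x y hx hy hxy
    have h1 := hpol (U x, V x) (U y, V y) (hzero x hx) (hzero y hy) hxy
    simp only at h1
    rw [show 2 * M j₁ j₁ * U x * U y + 2 * M j₁ j₂ * (U x * V y + U y * V x)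
        + 2 * M j₂ j₂ * V x * V y =
      2 * (M j₁ j₁ * U x * U y + M j₁ j₂ * (U x * V y + U y * V x) + M j₂ j₂ * V x * V y) by ring]
      at h1
    -- `ℓ^(γ - t)` divides the binary part
    have h3 : (ℓ : ℤ) ^ (γ - t) ∣
        M j₁ j₁ * U x * U y + M j₁ j₂ * (U x * V y + U y * V x) + M j₂ j₂ * V x * V y := by
      by_cases h2ℓ : ℓ = 2
      · have ht1 : t = 1 := by rw [ht, if_pos h2ℓ]
        rw [ht1]
        rcases Nat.eq_zero_or_pos γ with hγ0 | hγpos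
        · rw [hγ0]; simp
        · have hP2 : (ℓ : ℤ) = 2 := by rw [h2ℓ]; norm_num
          rw [show γ = (γ - 1) + 1 by omega, pow_succ, hP2] at h1
          rw [hP2]
          rw [mul_comm (2 : ℤ)] at h1
          exact (mul_dvd_mul_iff_right (two_ne_zero : (2 : ℤ) ≠ 0)).mp h1
      · have ht0 : t = 0 := by rw [ht, if_neg h2ℓ]
        rw [ht0, Nat.sub_zero]
        have h2P : ¬ (ℓ : ℤ) ∣ 2 := by
          intro h22
          have h23 : ℓ ∣ 2 := by exact_mod_cast h22
          exact h2ℓ ((Nat.prime_dvd_prime_iff_eq hℓ Nat.prime_two).mp h23)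
        have hcop : IsCoprime ((ℓ : ℤ) ^ γ) 2 := ((Prime.coprime_iff_not_dvd hℓ').2 h2P).pow_left
        exact hcop.dvd_of_dvd_mul_left h1
    have h4 : (ℓ : ℤ) ^ (γ - t) ∣ x ⬝ᵥ M *ᵥ y -
        (M j₁ j₁ * U x * U y + M j₁ j₂ * (U x * V y + U y * V x) + M j₂ j₂ * V x * V y) :=
      (pow_dvd_pow (ℓ : ℤ) (Nat.sub_le γ t)).trans (hrem x y)
    have := dvd_add h4 h3
    rwa [sub_add_cancel] at this

end TernaryConic

end Literature.NumberTheory.DiophantineGeometry
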